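/-
Copyright: b2b-lace packet (LEAN TYPING SEAT 1 gen 37, node KU-SEP-MUNIFORM-ENVELOPE: the m-UNIFORM ENVELOPE of
the row-truncated twisted Bessel object at an arbitrary truncation order `J` — the `J ≥ 1` successor of the
`J = 0` device of `SrwTwistTruncationSeeds` / `SrwTwistMUniformLitBound`). d-generic; number-free apart from
the universal Bessel order-tail helper; what-if / input-certification lane SUPPORT; nothing here is a
certificate; no statement at any fixed dimension.
-/
import Literature.Probability.FitznerVanDerHofstad2017.SrwTwistTruncationSeeds
import Literature.Probability.FitznerVanDerHofstad2017.SrwIntegralMonotone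
import Literature.Probability.FitznerVanDerHofstad2017.SrwIntegralJFarField
import Literature.Analysis.FunctionSpaces.BesselJOrderTailGeometric
import Mathlib.Data.Nat.Choose.Multinomial
import HarnessLib

/-!
# The m-uniform ENVELOPE of the row-truncated twisted seed (every truncation order `J`)

CITATION HEADER (PLACEMENT v2). Part of the certified REPRODUCTION of the numerical inputs of
R. Fitzner, R. van der Hofstad, *Generalized approach to the non-backtracking lace expansion*,
Probab. Theory Related Fields 169 (2017) 1041–1119 [NoBLE17-I] (arXiv:1506.07969): the SRW Fourier
integrals (3.34)–(3.36) p. 1071 and `I_{n,l}` (5.1) p. 1090 evaluated through Bessel rows, §5.1.1 (5.2)–(5.5)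
pp. 1089–1090 (the notebook `SRW.nb`), with the monotonicity of Lemma 5.1 p. 1093; Bessel facts from NIST DLMF
§10.2.2, §10.14.4, §10.35.2 [DLMF].  Nothing in this file is a claim of the paper beyond those formulas;
everything below is PROVED (standard axioms) from landed tree modules.

## What this module adds

`SrwTwistTruncationSeeds.abs_srwTwist_sub_rowTrunc_le_sum_srwI_unit` bounds, for EVERY `|m| ≥ M` at once, the
distance between the twisted seed `Tw_{n+1}(m e_i; β)` and the ROW-TRUNCATED OBJECT
`R_J(m, β) = (n!)⁻¹ (∫₀^∞ τⁿ e^{-τ} Re P_J(τ/d, β/d)^d dτ)/(2π)^d`,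
`P_J(v, y) = Σ_{j ≤ J} ε_j I_{jm}(v) · 2π iʲ J_j(y)`, by two-level plain seeds at `(J+1)M`.  For `J = 0` the object
`R_0` is the main term `J_0(β/d)^d · srwI d (n+1) 0 0`; for `J ≥ 1` it still depends on `m`.  This module makes
`R_J` m-UNIFORM for every `J`:

* `rowTruncObj_eq_sum_piAntidiag` — the multinomial expansion
  `R_J(m, β) = Σ_k multinomial(k) · c_k(β/d) · srwI d (n+1) 0 (x(k, m))` over the COUNT VECTORS
  `k : Fin (J+1) → ℕ`, `Σ_j k_j = d` (`Finset.piAntidiag univ d`), with the real coefficient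
  `c_k(y) = Re(i^{Σ_j j k_j}) · Π_j (ε_j J_j(y))^{k_j}` (`cntCoef`) and the PROFILE POINT `x(k, m) ∈ ℤ^d` with `k_j`
  coordinates equal to `j·m` (`cntProfile`, nonzero orders first; `e^{-τ} Π_j I_{jm}(τ/d)^{k_j} = Π_μ q_{τ/d}(x_μ)`
  and the Bessel `u`-representation `srwI_succ_zero_eq_integral_prod_srwHeatKernel_div`);
* `abs_rowTruncObj_sub_main_le` — THE ENVELOPE: the seed at a profile point is nonnegative and non-increasing in
  `|m|` (`absMonotone_srwI`), so for every table `U_k ≥ srwI d (n+1) 0 (x(k, M))`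
  `|R_J(m, β) − J_0(β/d)^d · srwI d (n+1) 0 0| ≤ max(NEG, POS)`, `NEG/POS = Σ_{k ≠ (d,0,…,0)} multinomial(k)·c_k^∓·U_k`,
  for ALL `|m| ≥ M`;
* `abs_srwTwist_sub_lit_pow_mul_srwI_le_envelope_cast` — the LITERAL form a kernel-decided consumer uses: from
  rational Bessel literals `|p_j − J_j(β/d)| ≤ e` (`j ≤ J`), an order-tail bound `Σ_{l≥0}|J_{l+J+1}(β/d)| ≤ δ̄`,
  a rational seed table `U` on the count vectors (`Finset.Nat.antidiagonalTuple (J+1) d`, the computable form of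
  the index set), two-level seeds `I_k` at `(J+1)M` and `srwI d (n+1) 0 0 ≤ T̄`:
  `|Tw_{n+1}(m e_i; β) − p_0^d · srwI d (n+1) 0 0| ≤ envQ + Σ_{k<d} C(d,k+1)(2δ̄)^{k+1} I_k + d·e·(|p_0|+e)^{d−1}·T̄`,
  where `envQ = max(negEnvQ, posEnvQ)` sums `multinomial(k) · Π_j(ε_j(|p_j|+e))^{k_j} · U_k` over the count
  vectors whose coefficient sign (`cntSgnQ`, decided from the literals: even powers are nonnegative, odd powers
  carry the sign of `p_j` when `|p_j| > e`) is not the harmless one;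
* `abs_srwTwist_sub_lit_pow_mul_srwI_le_envelope_twoLevel_cast` — the same with the profile seeds read off ONE
  two-level table `I_c ≥ srwI d (n+1) 0 (M(e_0+…+e_c))` by the number `d − k_0` of nonzero coordinates
  (`srwI_cntProfile_le_twoLevel`), the whole right-hand side the closed rational term `envBoundQ`;
* `tsum_abs_besselJ_orderTail_le_besselTailJQ` — the order tail `Σ_{l≥0}|J_{l+J+1}(y)| ≤ besselTailJQ J y Q`
  (`J ≤ 15`, `y² ≤ 4(J+2)`) from any 24-digit literal table `|Q_j/10²⁴ − J_j(y)| ≤ 10⁻²⁴`, `j < 17`: the orders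
  `J+1, …, 16` by the table, the rest by `BesselJOrderTailGeometric.tsum_abs_besselJ_orderTail_le_sum_add_geom`.

Everything is PROVED (standard axioms), generic in the dimension `d`; no instance, no table of values, no named
fact.  Epistemic status / lane: what-if / input-certification SUPPORT; nothing here is a certificate; no
statement at a specific dimension.

## References
* R. Fitzner, R. van der Hofstad, *Generalized approach to the non-backtracking lace expansion*,
  PTRF 169 (2017) 1041–1119 (arXiv:1506.07969), (3.34)–(3.36) p. 1071, §5.1.1 (5.1)–(5.5) pp. 1089–1090,
  Lemma 5.1 p. 1093. [FitznerVanDerHofstad2016NoBLE]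
* NIST DLMF §10.2.2, §10.14.4, §10.35.2. [DLMF]
[cite: FitznerVanDerHofstad2016NoBLE, (3.34)–(3.36) p. 1071, §5.1.1 (5.2)–(5.5) pp. 1089–1090; DLMF, 10.2.2, 10.14.4, 10.35.2]
-/

noncomputable section

open MeasureTheory Set Real Finset
open scoped Nat

namespace Literature.Probability.FitznerVanDerHofstad2017

open Literature.Probability.LatticeModels (besselI besselI_nonneg srwHeatKernel)
open Literature.Analysis.FunctionSpaces (besselJ tsum_abs_besselJ_orderTail_le_sum_add_geom)

variable {d : ℕ}

/-! ### Count vectors, order patterns and profile points -/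

/-- The order pattern of a count vector `k` over a list of orders: `k j` copies of `j`, in list order. [cite: FitznerVanDerHofstad2016NoBLE, (3.34)–(3.36) p. 1071, §5.1.1 (5.2)–(5.5) pp. 1089–1090; DLMF, 10.2.2, 10.14.4, 10.35.2] -/
def cntPatternAux {J : ℕ} (k : Fin (J + 1) → ℕ) (L : List (Fin (J + 1))) : List ℕ :=
  L.flatMap fun j => List.replicate (k j) (j : ℕ)

/-- The list of orders `1, 2, …, J, 0` (nonzero orders first, so that profile points carry their nonzero
coordinates first, like the tree's class points `clsPt`). [cite: FitznerVanDerHofstad2016NoBLE, (3.34)–(3.36) p. 1071, §5.1.1 (5.2)–(5.5) pp. 1089–1090; DLMF, 10.2.2, 10.14.4, 10.35.2] -/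
def cntOrderList (J : ℕ) : List (Fin (J + 1)) := (List.finRange J).map Fin.succ ++ [0]

/-- The order pattern of a count vector `k : Fin (J+1) → ℕ`: `k 1` ones, `k 2` twos, …, `k J` copies of `J`,
then `k 0` zeros. [cite: FitznerVanDerHofstad2016NoBLE, (3.34)–(3.36) p. 1071, §5.1.1 (5.2)–(5.5) pp. 1089–1090; DLMF, 10.2.2, 10.14.4, 10.35.2] -/
def cntPattern {J : ℕ} (k : Fin (J + 1) → ℕ) : List ℕ := cntPatternAux k (cntOrderList J)

/-- The profile point of a count vector at axis distance `m`: the lattice point of `ℤ^d` whose `μ`-th coordinate is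
`(pattern entry μ) · m` (`k j` coordinates equal to `j·m`; zero beyond the pattern). [cite: FitznerVanDerHofstad2016NoBLE, (3.34)–(3.36) p. 1071, §5.1.1 (5.2)–(5.5) pp. 1089–1090; DLMF, 10.2.2, 10.14.4, 10.35.2] -/
def cntProfile (d : ℕ) {J : ℕ} (k : Fin (J + 1) → ℕ) (m : ℤ) : Fin d → ℤ :=
  fun μ => (((cntPattern k).getD (μ : ℕ) 0 : ℕ) : ℤ) * m

/-- The total order `s(k) = Σ_j j·k_j` of a count vector. [cite: FitznerVanDerHofstad2016NoBLE, (3.34)–(3.36) p. 1071, §5.1.1 (5.2)–(5.5) pp. 1089–1090; DLMF, 10.2.2, 10.14.4, 10.35.2] -/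
def cntOrderSum {J : ℕ} (k : Fin (J + 1) → ℕ) : ℕ := ∑ j : Fin (J + 1), (j : ℕ) * k j

/-- `Re(i^s)`: `1, 0, -1, 0` according to `s mod 4`. [cite: FitznerVanDerHofstad2016NoBLE, (3.34)–(3.36) p. 1071, §5.1.1 (5.2)–(5.5) pp. 1089–1090; DLMF, 10.2.2, 10.14.4, 10.35.2] -/
def reIPow (s : ℕ) : ℤ := if s % 4 = 0 then 1 else if s % 4 = 2 then -1 else 0

/-- The real row coefficient of a count vector at `y`: `Re(i^{s(k)}) · Π_j (ε_j J_j(y))^{k_j}`, `ε_0 = 1`, `ε_j = 2`. [cite: FitznerVanDerHofstad2016NoBLE, (3.34)–(3.36) p. 1071, §5.1.1 (5.2)–(5.5) pp. 1089–1090; DLMF, 10.2.2, 10.14.4, 10.35.2] -/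
def cntCoef {J : ℕ} (k : Fin (J + 1) → ℕ) (y : ℝ) : ℝ :=
  (reIPow (cntOrderSum k) : ℝ) * ∏ j : Fin (J + 1), ((if (j : ℕ) = 0 then (1 : ℝ) else 2) * besselJ j y) ^ k j

/-- The count vector of the main term: all `d` factors of order `0`. [cite: FitznerVanDerHofstad2016NoBLE, (3.34)–(3.36) p. 1071, §5.1.1 (5.2)–(5.5) pp. 1089–1090; DLMF, 10.2.2, 10.14.4, 10.35.2] -/
def cntZero (d J : ℕ) : Fin (J + 1) → ℕ := fun j => if j = 0 then d else 0

/-- The order pattern over a list has `Σ_{j ∈ L} k j` entries. [folklore] -/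
private theorem length_cntPatternAux {J : ℕ} (k : Fin (J + 1) → ℕ) (L : List (Fin (J + 1))) :
    (cntPatternAux k L).length = (L.map k).sum := by
  induction L with
  | nil => simp [cntPatternAux]
  | cons a t ih =>
    simp only [cntPatternAux, List.flatMap_cons, List.length_append, List.length_replicate, List.map_cons,
      List.sum_cons] at ih ⊢
    rw [ih]

/-- The order pattern has `Σ_j k_j` entries. [folklore] -/
private theorem length_cntPattern {J : ℕ} (k : Fin (J + 1) → ℕ) : (cntPattern k).length = ∑ j, k j := by
  rw [cntPattern, length_cntPatternAux, cntOrderList, List.map_append, List.sum_append, List.map_map,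
    List.map_singleton, List.sum_singleton, Fin.sum_univ_succ, add_comm, Fin.sum_univ_def]
  rfl

/-- `(pattern over L).map g` multiplies to `Π_{j ∈ L} g(j)^{k j}`. [folklore] -/
private theorem prod_map_cntPatternAux {M : Type*} [CommMonoid M] {J : ℕ} (k : Fin (J + 1) → ℕ)
    (L : List (Fin (J + 1))) (g : ℕ → M) :
    ((cntPatternAux k L).map g).prod = (L.map fun j : Fin (J + 1) => g (j : ℕ) ^ k j).prod := by
  induction L with
  | nil => simp [cntPatternAux]
  | cons a t ih =>
    simp only [cntPatternAux, List.flatMap_cons, List.map_append, List.prod_append, List.map_replicate,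
      List.prod_replicate, List.map_cons, List.prod_cons] at ih ⊢
    rw [ih]

/-- `(cntPattern k).map g` multiplies to `Π_j g(j)^{k_j}`. [folklore] -/
private theorem prod_map_cntPattern {M : Type*} [CommMonoid M] {J : ℕ} (k : Fin (J + 1) → ℕ) (g : ℕ → M) :
    ((cntPattern k).map g).prod = ∏ j : Fin (J + 1), g (j : ℕ) ^ k j := by
  rw [cntPattern, prod_map_cntPatternAux, cntOrderList, List.map_append, List.prod_append, List.map_map,
    List.map_singleton, List.prod_singleton, Fin.prod_univ_succ, mul_comm, Fin.prod_univ_def]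
  rfl

/-- `Π_{μ < |l|} g (l.getD μ 0) = (l.map g).prod`. [folklore] -/
private theorem prod_univ_getD_eq_prod_map {M : Type*} [CommMonoid M] (g : ℕ → M) :
    ∀ l : List ℕ, ∏ μ : Fin l.length, g (l.getD (μ : ℕ) 0) = (l.map g).prod
  | [] => by simp
  | a :: t => by
    rw [List.length_cons, Fin.prod_univ_succ]
    simp only [Fin.val_zero, List.getD_cons_zero, Fin.val_succ, List.getD_cons_succ, List.map_cons,
      List.prod_cons]
    rw [prod_univ_getD_eq_prod_map g t]

/-- For a count vector with `Σ_j k_j = d`: `Π_{μ : Fin d} g(pattern_μ) = Π_j g(j)^{k_j}`. [folklore] -/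
private theorem prod_univ_cntPattern_getD {M : Type*} [CommMonoid M] {J : ℕ} {k : Fin (J + 1) → ℕ}
    (hk : ∑ j, k j = d) (g : ℕ → M) :
    ∏ μ : Fin d, g ((cntPattern k).getD (μ : ℕ) 0) = ∏ j : Fin (J + 1), g (j : ℕ) ^ k j := by
  have hlen : (cntPattern k).length = d := by rw [length_cntPattern, hk]
  rw [← prod_map_cntPattern k g, ← prod_univ_getD_eq_prod_map g (cntPattern k)]
  exact (Fintype.prod_equiv (finCongr hlen.symm) _ _ fun μ => rfl)

/-- **The seed product at a profile point**: for `Σ_j k_j = d`,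
`e^{-τ} Π_j I_{j m}(τ/d)^{k_j} = Π_μ q_{τ/d}((cntProfile d k m)_μ)`. [folklore] -/
private theorem exp_neg_mul_prod_besselI_pow_eq_prod_srwHeatKernel_cntProfile (hd : 1 ≤ d) {J : ℕ}
    {k : Fin (J + 1) → ℕ} (hk : ∑ j, k j = d) (m : ℤ) (τ : ℝ) :
    Real.exp (-τ) * ∏ j : Fin (J + 1), besselI ((j : ℕ) * m) (τ / d) ^ k j
      = ∏ μ : Fin d, srwHeatKernel (τ / d) (cntProfile d k m μ) := by
  have hd0 : (d : ℝ) ≠ 0 := by exact_mod_cast (by omega : d ≠ 0)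
  have h1 : ∏ μ : Fin d, srwHeatKernel (τ / d) (cntProfile d k m μ)
      = ∏ μ : Fin d, (fun o : ℕ => srwHeatKernel (τ / d) ((o : ℤ) * m)) ((cntPattern k).getD (μ : ℕ) 0) := by
    rfl
  rw [h1, prod_univ_cntPattern_getD hk (g := fun o : ℕ => srwHeatKernel (τ / d) ((o : ℤ) * m))]
  simp only [srwHeatKernel_eq_exp_neg_mul_besselI, mul_pow, Finset.prod_mul_distrib,
    Finset.prod_pow_eq_pow_sum, hk]
  congr 1
  rw [← Real.exp_nat_mul]
  congr 1
  field_simp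

/-! ### `Re(i^s)` -/

/-- `Re(i^s) = reIPow s`. [folklore] -/
private theorem re_I_pow (s : ℕ) : (Complex.I ^ s).re = (reIPow s : ℝ) := by
  have h4 : Complex.I ^ 4 = 1 := by
    rw [show (4 : ℕ) = 2 * 2 from rfl, pow_mul, Complex.I_sq]; norm_num
  have hI : Complex.I ^ s = Complex.I ^ (s % 4) := by
    conv_lhs => rw [← Nat.mod_add_div s 4, pow_add, pow_mul, h4, one_pow, mul_one]
  rw [hI]
  unfold reIPow
  have hs : s % 4 < 4 := Nat.mod_lt _ (by norm_num)
  generalize s % 4 = r at hs ⊢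
  interval_cases r
  · simp
  · simp
  · simp [Complex.I_sq]
  · simp [pow_succ]

/-! ### The pointwise multinomial expansion of `Re P_J(v, y)^d` -/

/-- `Re P_J(v,y)^d = (2π)^d Σ_{k} multinomial(k) · cntCoef k y · Π_j I_{jm}(v)^{k_j}`, the sum over the count vectors
`k : Fin (J+1) → ℕ` with `Σ_j k_j = d` (`Finset.piAntidiag univ d`). [cite: FitznerVanDerHofstad2016NoBLE, (3.34)–(3.36) p. 1071, §5.1.1 (5.2)–(5.5) pp. 1089–1090; DLMF, 10.2.2, 10.14.4, 10.35.2] -/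
theorem re_rowPoly_pow_eq_sum_piAntidiag (J : ℕ) (m : ℤ) (v y : ℝ) :
    ((∑ j ∈ Finset.range (J + 1), (if j = 0 then (1 : ℂ) else 2)
        * ((besselI (j * m) v : ℂ) * (2 * π * Complex.I ^ j * (besselJ j y : ℂ)))) ^ d).re
      = (2 * π) ^ d * ∑ k ∈ (Finset.univ : Finset (Fin (J + 1))).piAntidiag d,
          (Nat.multinomial Finset.univ k : ℝ) * cntCoef k y
            * ∏ j : Fin (J + 1), besselI ((j : ℕ) * m) v ^ k j := by
  -- pass to a `Fin (J+1)`-indexed sum and expand by the multinomial theorem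
  rw [Finset.sum_range (fun j => (if j = 0 then (1 : ℂ) else 2)
        * ((besselI (j * m) v : ℂ) * (2 * π * Complex.I ^ j * (besselJ j y : ℂ)))),
    Finset.sum_pow_eq_sum_piAntidiag, Complex.re_sum, Finset.mul_sum]
  refine Finset.sum_congr rfl fun k hk => ?_
  rw [Finset.mem_piAntidiag] at hk
  have hsum : ∑ j, k j = d := by simpa using hk.1
  -- each factor: `F_j = 2π · iʲ · (ε_j J_j(y)) · I_{jm}(v)`
  have hfac1 : ∀ j : Fin (J + 1),
      (if ((j : ℕ)) = 0 then (1 : ℂ) else 2)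
        * ((besselI ((j : ℕ) * m) v : ℂ) * (2 * π * Complex.I ^ (j : ℕ) * (besselJ j y : ℂ)))
      = ((2 * π : ℝ) : ℂ) * Complex.I ^ (j : ℕ)
        * ((((if (j : ℕ) = 0 then (1 : ℝ) else 2) * besselJ j y : ℝ)) : ℂ)
        * ((besselI ((j : ℕ) * m) v : ℝ) : ℂ) := by
    intro j
    split_ifs <;> push_cast <;> ring
  have hfac : ∀ j : Fin (J + 1),
      ((if ((j : ℕ)) = 0 then (1 : ℂ) else 2)
        * ((besselI ((j : ℕ) * m) v : ℂ) * (2 * π * Complex.I ^ (j : ℕ) * (besselJ j y : ℂ)))) ^ k j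
      = ((2 * π : ℝ) : ℂ) ^ k j * Complex.I ^ ((j : ℕ) * k j)
        * ((((if (j : ℕ) = 0 then (1 : ℝ) else 2) * besselJ j y) ^ k j : ℝ) : ℂ)
        * (((besselI ((j : ℕ) * m) v ^ k j : ℝ)) : ℂ) := by
    intro j
    rw [hfac1 j, mul_pow, mul_pow, mul_pow, ← pow_mul, Complex.ofReal_pow, Complex.ofReal_pow]
  have hprod : ∏ j : Fin (J + 1), ((if ((j : ℕ)) = 0 then (1 : ℂ) else 2)
        * ((besselI ((j : ℕ) * m) v : ℂ) * (2 * π * Complex.I ^ (j : ℕ) * (besselJ j y : ℂ)))) ^ k j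
      = ((2 * π : ℝ) : ℂ) ^ d * Complex.I ^ cntOrderSum k
        * ((∏ j : Fin (J + 1), ((if (j : ℕ) = 0 then (1 : ℝ) else 2) * besselJ j y) ^ k j : ℝ) : ℂ)
        * ((∏ j : Fin (J + 1), besselI ((j : ℕ) * m) v ^ k j : ℝ) : ℂ) := by
    rw [Finset.prod_congr rfl fun j _ => hfac j, Finset.prod_mul_distrib, Finset.prod_mul_distrib,
      Finset.prod_mul_distrib, Finset.prod_pow_eq_pow_sum, Finset.prod_pow_eq_pow_sum, hsum,
      ← Complex.ofReal_prod, ← Complex.ofReal_prod]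
    rfl
  rw [hprod]
  have e1 : (Nat.multinomial Finset.univ k : ℂ) * (((2 * π : ℝ) : ℂ) ^ d * Complex.I ^ cntOrderSum k
        * ((∏ j : Fin (J + 1), ((if (j : ℕ) = 0 then (1 : ℝ) else 2) * besselJ j y) ^ k j : ℝ) : ℂ)
        * ((∏ j : Fin (J + 1), besselI ((j : ℕ) * m) v ^ k j : ℝ) : ℂ))
      = (((Nat.multinomial Finset.univ k : ℝ) * ((2 * π) ^ d
          * (∏ j : Fin (J + 1), ((if (j : ℕ) = 0 then (1 : ℝ) else 2) * besselJ j y) ^ k j)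
          * ∏ j : Fin (J + 1), besselI ((j : ℕ) * m) v ^ k j) : ℝ) : ℂ) * Complex.I ^ cntOrderSum k := by
    simp only [Complex.ofReal_mul, Complex.ofReal_pow, Complex.ofReal_natCast, Complex.ofReal_ofNat]
    ring
  rw [e1, Complex.re_ofReal_mul, re_I_pow]
  simp only [cntCoef]
  ring


/-! ### The row-truncated object and its expansion into plain seeds -/

/-- The ROW-TRUNCATED OBJECT `R_J(m, β) = (n!)⁻¹ (∫₀^∞ τⁿ e^{-τ} Re P_J(τ/d, β/d)^d dτ)/(2π)^d` — the anchor of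
`abs_srwTwist_sub_rowTrunc_le_sum_srwI_unit` (verbatim). [cite: FitznerVanDerHofstad2016NoBLE, (3.34)–(3.36) p. 1071, §5.1.1 (5.2)–(5.5) pp. 1089–1090; DLMF, 10.2.2, 10.14.4, 10.35.2] -/
def rowTruncObj (d n J : ℕ) (m : ℤ) (β : ℝ) : ℝ :=
  (n ! : ℝ)⁻¹ * (∫ τ in Ioi (0:ℝ), τ ^ n * (Real.exp (-τ) *
      ((∑ j ∈ Finset.range (J + 1), (if j = 0 then (1 : ℂ) else 2)
        * ((besselI (j * m) (τ / d) : ℂ)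
          * (2 * π * Complex.I ^ j * (besselJ j (β / d) : ℂ)))) ^ d).re)) / (2 * π) ^ d

/-- **The row-truncated object is a finite signed combination of plain seeds at profile points**:
`R_J(m,β) = Σ_k multinomial(k) · cntCoef k (β/d) · srwI d (n+1) 0 (cntProfile d k m)` over the count vectors
`k : Fin (J+1) → ℕ`, `Σ_j k_j = d` (multinomial theorem, `e^{-τ}Π_j I_{jm}(τ/d)^{k_j} = Π_μ q_{τ/d}(x_μ)` and the
Bessel `u`-representation of `I_{n+1,0}`). [cite: FitznerVanDerHofstad2016NoBLE, (3.34)–(3.36) p. 1071, §5.1.1 (5.2)–(5.5) pp. 1089–1090; DLMF, 10.2.2, 10.14.4, 10.35.2] -/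
theorem rowTruncObj_eq_sum_piAntidiag (n : ℕ) (hd : 2 * n + 3 ≤ d) (J : ℕ) (m : ℤ) (β : ℝ) :
    rowTruncObj d n J m β = ∑ k ∈ (Finset.univ : Finset (Fin (J + 1))).piAntidiag d,
      (Nat.multinomial Finset.univ k : ℝ) * cntCoef k (β / d) * srwI d (n + 1) 0 (cntProfile d k m) := by
  have hd1 : 1 ≤ d := by omega
  have hπ : (0 : ℝ) < π := Real.pi_pos
  have hn0 : (n ! : ℝ) ≠ 0 := by positivity
  unfold rowTruncObj
  have hpt : ∀ τ : ℝ, τ ^ n * (Real.exp (-τ) *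
      ((∑ j ∈ Finset.range (J + 1), (if j = 0 then (1 : ℂ) else 2)
        * ((besselI (j * m) (τ / d) : ℂ)
          * (2 * π * Complex.I ^ j * (besselJ j (β / d) : ℂ)))) ^ d).re)
      = ∑ k ∈ (Finset.univ : Finset (Fin (J + 1))).piAntidiag d,
          ((2 * π) ^ d * ((Nat.multinomial Finset.univ k : ℝ) * cntCoef k (β / d)))
            * (τ ^ n * ∏ μ : Fin d, srwHeatKernel (τ / d) (cntProfile d k m μ)) := by
    intro τ
    rw [re_rowPoly_pow_eq_sum_piAntidiag J m (τ / d) (β / d), Finset.mul_sum, Finset.mul_sum, Finset.mul_sum]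
    refine Finset.sum_congr rfl fun k hk => ?_
    have hsum : ∑ j, k j = d := by rw [Finset.mem_piAntidiag] at hk; simpa using hk.1
    rw [← exp_neg_mul_prod_besselI_pow_eq_prod_srwHeatKernel_cntProfile hd1 hsum m τ]
    ring
  simp_rw [hpt]
  rw [integral_finsetSum _ (fun k _ =>
    ((integrableOn_pow_mul_prod_srwHeatKernel n hd (cntProfile d k m)).const_mul _))]
  simp_rw [integral_const_mul]
  rw [Finset.mul_sum, Finset.sum_div]
  refine Finset.sum_congr rfl fun k _ => ?_
  rw [srwI_succ_zero_eq_integral_prod_srwHeatKernel_div n hd (cntProfile d k m)]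
  field_simp

/-! ### The main count vector `(d, 0, …, 0)` and elementary properties -/

/-- `Σ_j (cntZero d J) j = d`. [folklore] -/
private theorem sum_cntZero (d J : ℕ) : ∑ j, cntZero d J j = d := by
  simp [cntZero, Finset.sum_ite_eq']

/-- The main count vector lies in `piAntidiag univ d`. [folklore] -/
private theorem cntZero_mem_piAntidiag (d J : ℕ) :
    cntZero d J ∈ (Finset.univ : Finset (Fin (J + 1))).piAntidiag d := by
  rw [Finset.mem_piAntidiag]
  exact ⟨by simpa using sum_cntZero d J, fun _ _ => Finset.mem_univ _⟩

/-- `cntZero d J 0 = d`. [folklore] -/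
private theorem cntZero_apply_zero (d J : ℕ) : cntZero d J 0 = d := by simp [cntZero]

/-- A count vector with `Σ_j k_j = d` and `k 0 = d` is the main count vector. [folklore] -/
private theorem eq_cntZero_of_apply_zero {J : ℕ} {k : Fin (J + 1) → ℕ} (hk : ∑ j, k j = d) (h0 : k 0 = d) :
    k = cntZero d J := by
  funext j
  by_cases hj : j = 0
  · subst hj; simp [cntZero, h0]
  · simp only [cntZero, hj, if_false]
    have hsplit := Fin.sum_univ_succ k
    rw [hk, h0] at hsplit
    have hz : ∑ i : Fin J, k i.succ = 0 := by omega
    obtain ⟨i, rfl⟩ := Fin.exists_succ_eq.mpr hj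
    exact (Finset.sum_eq_zero_iff.mp hz) i (Finset.mem_univ _)

/-- `multinomial(d, 0, …, 0) = 1`. [folklore] -/
private theorem multinomial_cntZero (d J : ℕ) : Nat.multinomial Finset.univ (cntZero d J) = 1 := by
  have h := Nat.multinomial_spec (Finset.univ : Finset (Fin (J + 1))) (cntZero d J)
  rw [sum_cntZero] at h
  have hp : ∏ j : Fin (J + 1), (cntZero d J j)! = d ! := by
    have e : ∀ j : Fin (J + 1), (cntZero d J j)! = if j = 0 then d ! else 1 := by
      intro j; unfold cntZero
      by_cases hj : j = 0
      · subst hj; simp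
      · simp [hj]
    rw [Finset.prod_congr rfl fun j _ => e j, Finset.prod_ite_eq']
    simp
  rw [hp] at h
  have hd : 0 < d ! := Nat.factorial_pos d
  nlinarith

/-- The main count vector has total order `0`. [folklore] -/
private theorem cntOrderSum_cntZero (d J : ℕ) : cntOrderSum (cntZero d J) = 0 := by
  unfold cntOrderSum cntZero
  refine Finset.sum_eq_zero fun j _ => ?_
  split_ifs with h
  · rw [h, Fin.val_zero, zero_mul]
  · rw [mul_zero]

/-- The coefficient of the main count vector is `J_0(y)^d`. [folklore] -/
private theorem cntCoef_cntZero (d J : ℕ) (y : ℝ) : cntCoef (cntZero d J) y = besselJ 0 y ^ d := by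
  unfold cntCoef
  rw [cntOrderSum_cntZero]
  simp only [reIPow, Nat.zero_mod, if_true, Int.cast_one, one_mul]
  have e : ∀ j : Fin (J + 1), ((if (j : ℕ) = 0 then (1 : ℝ) else 2) * besselJ j y) ^ cntZero d J j
      = if j = 0 then besselJ 0 y ^ d else 1 := by
    intro j; unfold cntZero
    by_cases hj : j = 0
    · subst hj; simp
    · have hj' : (j : ℕ) ≠ 0 := fun h => hj (Fin.ext h)
      simp [hj, hj']
  rw [Finset.prod_congr rfl fun j _ => e j, Finset.prod_ite_eq']
  simp

/-- Every entry of the order pattern is an order `j` with `k j ≠ 0`. [folklore] -/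
private theorem exists_of_mem_cntPattern {J : ℕ} {k : Fin (J + 1) → ℕ} {a : ℕ} (ha : a ∈ cntPattern k) :
    ∃ j : Fin (J + 1), k j ≠ 0 ∧ a = j := by
  unfold cntPattern cntPatternAux at ha
  rw [List.mem_flatMap] at ha
  obtain ⟨j, _, hj⟩ := ha
  rw [List.mem_replicate] at hj
  exact ⟨j, hj.1, hj.2⟩

/-- A pattern entry (with default `0`) is `0` or an order `j` with `k j ≠ 0`. [folklore] -/
private theorem cntPattern_getD_eq_zero_or {J : ℕ} (k : Fin (J + 1) → ℕ) (μ : ℕ) :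
    (cntPattern k).getD μ 0 = 0 ∨ ∃ j : Fin (J + 1), k j ≠ 0 ∧ (cntPattern k).getD μ 0 = j := by
  rw [List.getD_eq_getElem?_getD]
  cases h : (cntPattern k)[μ]? with
  | none => left; rfl
  | some a =>
    right
    simp only [Option.getD_some]
    exact exists_of_mem_cntPattern (List.mem_of_getElem? h)

/-- The profile point of the main count vector is the origin. [folklore] -/
private theorem cntProfile_cntZero (d J : ℕ) (m : ℤ) : cntProfile d (cntZero d J) m = fun _ => 0 := by
  funext μ
  unfold cntProfile
  rcases cntPattern_getD_eq_zero_or (cntZero d J) (μ : ℕ) with h | ⟨j, hj, h⟩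
  · rw [h]; simp
  · have hj0 : j = 0 := by
      by_contra hne
      unfold cntZero at hj
      rw [if_neg hne] at hj
      exact hj rfl
    rw [h, hj0, Fin.val_zero]; simp

/-- Profile points grow coordinatewise in `|m|`: `|x(k, M)_μ| ≤ |x(k, m)_μ|` for `M ≤ |m|`. [cite: FitznerVanDerHofstad2016NoBLE, (3.34)–(3.36) p. 1071, §5.1.1 (5.2)–(5.5) pp. 1089–1090; DLMF, 10.2.2, 10.14.4, 10.35.2] -/
theorem abs_cntProfile_le {J : ℕ} (k : Fin (J + 1) → ℕ) {M : ℕ} {m : ℤ} (hM : M ≤ m.natAbs) (μ : Fin d) :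
    |cntProfile d k (M : ℤ) μ| ≤ |cntProfile d k m μ| := by
  unfold cntProfile
  rw [abs_mul, abs_mul, Nat.abs_cast, Nat.abs_cast]
  gcongr
  rw [Int.abs_eq_natAbs]
  exact_mod_cast hM

/-- The seeds at profile points are non-increasing in `|m|` (`absMonotone_srwI`). [cite: FitznerVanDerHofstad2016NoBLE, (3.34)–(3.36) p. 1071, §5.1.1 (5.2)–(5.5) pp. 1089–1090; DLMF, 10.2.2, 10.14.4, 10.35.2] -/
theorem srwI_cntProfile_le (n : ℕ) (hd : 2 * (n + 1) + 1 ≤ d) {J : ℕ} (k : Fin (J + 1) → ℕ) {M : ℕ} {m : ℤ}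
    (hM : M ≤ m.natAbs) :
    srwI d (n + 1) 0 (cntProfile d k m) ≤ srwI d (n + 1) 0 (cntProfile d k (M : ℤ)) :=
  absMonotone_srwI (d := d) (n := n + 1) (by omega) hd 0 _ _ fun μ => abs_cntProfile_le k hM μ

/-! ### The m-uniform envelope of the row-truncated object -/

/-- `−a·c⁻·U ≤ a·c·I ≤ a·c⁺·U` for `0 ≤ a`, `0 ≤ I ≤ U`. [folklore] -/
private theorem term_bounds {a c I U : ℝ} (ha : 0 ≤ a) (hI0 : 0 ≤ I) (hIU : I ≤ U) :
    -(a * max (-c) 0 * U) ≤ a * c * I ∧ a * c * I ≤ a * max c 0 * U := by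
  rcases le_total 0 c with hc | hc
  · rw [max_eq_right (by linarith : -c ≤ 0), max_eq_left hc]
    refine ⟨?_, ?_⟩
    · have : 0 ≤ a * c * I := by positivity
      linarith
    · exact mul_le_mul_of_nonneg_left hIU (mul_nonneg ha hc)
  · rw [max_eq_left (by linarith : 0 ≤ -c), max_eq_right hc]
    refine ⟨?_, ?_⟩
    · have h1 : a * c * U ≤ a * c * I := mul_le_mul_of_nonpos_left hIU (by nlinarith)
      linarith
    · have : a * c * I ≤ 0 := by nlinarith [mul_nonneg ha hI0]
      linarith

/-- **THE m-UNIFORM ENVELOPE.** For `2(n+1)+1 ≤ d`, every truncation order `J`, every `M ≤ |m|`, every `β` and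
every table `U` with `srwI d (n+1) 0 (cntProfile d k M) ≤ U k` on the count vectors:
`|R_J(m,β) − J_0(β/d)^d · srwI d (n+1) 0 0| ≤ max(NEG, POS)`,
`NEG = Σ_{k ≠ k₀} multinomial(k)·(cntCoef k)⁻·U k`, `POS = Σ_{k ≠ k₀} multinomial(k)·(cntCoef k)⁺·U k` — uniformly in
`|m| ≥ M` (the seed at a profile point is nonnegative and non-increasing in `|m|`). [cite: FitznerVanDerHofstad2016NoBLE, (3.34)–(3.36) p. 1071, §5.1.1 (5.2)–(5.5) pp. 1089–1090; DLMF, 10.2.2, 10.14.4, 10.35.2] -/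
theorem abs_rowTruncObj_sub_main_le (n : ℕ) (hd : 2 * (n + 1) + 1 ≤ d) (J M : ℕ) {m : ℤ}
    (hM : M ≤ m.natAbs) (β : ℝ) {U : (Fin (J + 1) → ℕ) → ℝ}
    (hU : ∀ k ∈ (Finset.univ : Finset (Fin (J + 1))).piAntidiag d,
      srwI d (n + 1) 0 (cntProfile d k (M : ℤ)) ≤ U k) :
    |rowTruncObj d n J m β - besselJ 0 (β / d) ^ d * srwI d (n + 1) 0 (fun _ => 0)|
      ≤ max (∑ k ∈ ((Finset.univ : Finset (Fin (J + 1))).piAntidiag d).erase (cntZero d J),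
              (Nat.multinomial Finset.univ k : ℝ) * max (-cntCoef k (β / d)) 0 * U k)
            (∑ k ∈ ((Finset.univ : Finset (Fin (J + 1))).piAntidiag d).erase (cntZero d J),
              (Nat.multinomial Finset.univ k : ℝ) * max (cntCoef k (β / d)) 0 * U k) := by
  have hd3 : 2 * n + 3 ≤ d := by omega
  rw [rowTruncObj_eq_sum_piAntidiag n hd3 J m β,
    ← Finset.add_sum_erase _ _ (cntZero_mem_piAntidiag d J), multinomial_cntZero, cntCoef_cntZero,
    cntProfile_cntZero, Nat.cast_one, one_mul, add_sub_cancel_left]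
  set A := ((Finset.univ : Finset (Fin (J + 1))).piAntidiag d).erase (cntZero d J) with hA
  have hkey : ∀ k ∈ A,
      -((Nat.multinomial Finset.univ k : ℝ) * max (-cntCoef k (β / d)) 0 * U k)
        ≤ (Nat.multinomial Finset.univ k : ℝ) * cntCoef k (β / d) * srwI d (n + 1) 0 (cntProfile d k m)
      ∧ (Nat.multinomial Finset.univ k : ℝ) * cntCoef k (β / d) * srwI d (n + 1) 0 (cntProfile d k m)
        ≤ (Nat.multinomial Finset.univ k : ℝ) * max (cntCoef k (β / d)) 0 * U k := by
    intro k hk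
    have hk' : k ∈ (Finset.univ : Finset (Fin (J + 1))).piAntidiag d := Finset.mem_of_mem_erase hk
    exact term_bounds (Nat.cast_nonneg _) (srwI_nonneg (n + 1) hd 0 _)
      ((srwI_cntProfile_le n hd k hM).trans (hU k hk'))
  rw [abs_le]
  constructor
  · have h1 : -(∑ k ∈ A, (Nat.multinomial Finset.univ k : ℝ) * max (-cntCoef k (β / d)) 0 * U k)
        ≤ ∑ k ∈ A, (Nat.multinomial Finset.univ k : ℝ) * cntCoef k (β / d)
          * srwI d (n + 1) 0 (cntProfile d k m) := by
      rw [← Finset.sum_neg_distrib]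
      exact Finset.sum_le_sum fun k hk => (hkey k hk).1
    have h2 := le_max_left (∑ k ∈ A, (Nat.multinomial Finset.univ k : ℝ) * max (-cntCoef k (β / d)) 0 * U k)
      (∑ k ∈ A, (Nat.multinomial Finset.univ k : ℝ) * max (cntCoef k (β / d)) 0 * U k)
    linarith
  · exact (Finset.sum_le_sum fun k hk => (hkey k hk).2).trans (le_max_right _ _)

/-! ### The literal layer: rational tables and the decided sign of each count vector -/

/-- Magnitude bound of `cntCoef k y` from `|p_j − J_j(y)| ≤ e`: `Π_j (ε_j (|p_j| + e))^{k_j}`. [cite: FitznerVanDerHofstad2016NoBLE, (3.34)–(3.36) p. 1071, §5.1.1 (5.2)–(5.5) pp. 1089–1090; DLMF, 10.2.2, 10.14.4, 10.35.2] -/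
def cntMagQ {J : ℕ} (p : ℕ → ℚ) (e : ℚ) (k : Fin (J + 1) → ℕ) : ℚ :=
  ∏ j : Fin (J + 1), ((if (j : ℕ) = 0 then (1 : ℚ) else 2) * (|p j| + e)) ^ k j

/-- The decided sign of `cntCoef k y` (`1` / `-1`; `0` = zero coefficient or undecided): `Re(i^{s(k)})` times the
signs of the odd powers `J_j(y)^{k_j}` read from `|p_j − J_j(y)| ≤ e`. [cite: FitznerVanDerHofstad2016NoBLE, (3.34)–(3.36) p. 1071, §5.1.1 (5.2)–(5.5) pp. 1089–1090; DLMF, 10.2.2, 10.14.4, 10.35.2] -/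
def cntSgnQ {J : ℕ} (p : ℕ → ℚ) (e : ℚ) (k : Fin (J + 1) → ℕ) : ℤ :=
  reIPow (cntOrderSum k)
    * ∏ j : Fin (J + 1), (if k j % 2 = 0 then (1 : ℤ) else if e < p j then 1 else if p j < -e then -1 else 0)

/-- One term of the envelope: `multinomial(k) · cntMagQ · U k`. [cite: FitznerVanDerHofstad2016NoBLE, (3.34)–(3.36) p. 1071, §5.1.1 (5.2)–(5.5) pp. 1089–1090; DLMF, 10.2.2, 10.14.4, 10.35.2] -/
def cntTermQ {J : ℕ} (p : ℕ → ℚ) (e : ℚ) (U : (Fin (J + 1) → ℕ) → ℚ) (k : Fin (J + 1) → ℕ) : ℚ :=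
  (Nat.multinomial Finset.univ k : ℚ) * cntMagQ p e k * U k

/-- The NEGATIVE envelope `NEG_J(M, β) ≤ negEnvQ`: the terms whose coefficient is not decided nonnegative. [cite: FitznerVanDerHofstad2016NoBLE, (3.34)–(3.36) p. 1071, §5.1.1 (5.2)–(5.5) pp. 1089–1090; DLMF, 10.2.2, 10.14.4, 10.35.2] -/
def negEnvQ (d J : ℕ) (p : ℕ → ℚ) (e : ℚ) (U : (Fin (J + 1) → ℕ) → ℚ) : ℚ :=
  ∑ k ∈ Finset.Nat.antidiagonalTuple (J + 1) d,
    if k 0 = d then 0 else if reIPow (cntOrderSum k) = 0 then 0 else if cntSgnQ p e k = 1 then 0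
      else cntTermQ p e U k

/-- The POSITIVE envelope `POS_J(M, β) ≤ posEnvQ`: the terms whose coefficient is not decided nonpositive. [cite: FitznerVanDerHofstad2016NoBLE, (3.34)–(3.36) p. 1071, §5.1.1 (5.2)–(5.5) pp. 1089–1090; DLMF, 10.2.2, 10.14.4, 10.35.2] -/
def posEnvQ (d J : ℕ) (p : ℕ → ℚ) (e : ℚ) (U : (Fin (J + 1) → ℕ) → ℚ) : ℚ :=
  ∑ k ∈ Finset.Nat.antidiagonalTuple (J + 1) d,
    if k 0 = d then 0 else if reIPow (cntOrderSum k) = 0 then 0 else if cntSgnQ p e k = -1 then 0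
      else cntTermQ p e U k

/-- The envelope `max(negEnvQ, posEnvQ)`. [cite: FitznerVanDerHofstad2016NoBLE, (3.34)–(3.36) p. 1071, §5.1.1 (5.2)–(5.5) pp. 1089–1090; DLMF, 10.2.2, 10.14.4, 10.35.2] -/
def envQ (d J : ℕ) (p : ℕ → ℚ) (e : ℚ) (U : (Fin (J + 1) → ℕ) → ℚ) : ℚ :=
  max (negEnvQ d J p e U) (posEnvQ d J p e U)

/-- `|cntCoef k y| ≤ cntMagQ p e k` from `|p_j − J_j(y)| ≤ e` (`j ≤ J`). [folklore] -/
private theorem abs_cntCoef_le_cntMagQ {J : ℕ} (k : Fin (J + 1) → ℕ) {y : ℝ} {p : ℕ → ℚ} {e : ℚ}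
    (hp : ∀ j : ℕ, j ≤ J → |(p j : ℝ) - besselJ j y| ≤ (e : ℝ)) :
    |cntCoef k y| ≤ ((cntMagQ p e k : ℚ) : ℝ) := by
  have hR : ((cntMagQ p e k : ℚ) : ℝ)
      = ∏ j : Fin (J + 1), ((if (j : ℕ) = 0 then (1 : ℝ) else 2) * (|(p j : ℝ)| + e)) ^ k j := by
    unfold cntMagQ
    push_cast
    refine Finset.prod_congr rfl fun j _ => ?_
    split_ifs <;> simp
  rw [hR]
  unfold cntCoef
  have hre : |(reIPow (cntOrderSum k) : ℝ)| ≤ 1 := by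
    unfold reIPow; split_ifs <;> simp
  rw [abs_mul, Finset.abs_prod]
  have hprod : ∏ j : Fin (J + 1), |((if (j : ℕ) = 0 then (1 : ℝ) else 2) * besselJ j y) ^ k j|
      ≤ ∏ j : Fin (J + 1), ((if (j : ℕ) = 0 then (1 : ℝ) else 2) * (|(p j : ℝ)| + e)) ^ k j := by
    refine Finset.prod_le_prod (fun j _ => abs_nonneg _) fun j _ => ?_
    rw [abs_pow]
    refine pow_le_pow_left₀ (abs_nonneg _) ?_ _
    rw [abs_mul]
    have hε : |(if (j : ℕ) = 0 then (1 : ℝ) else 2)| = (if (j : ℕ) = 0 then (1 : ℝ) else 2) := by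
      split_ifs <;> norm_num
    rw [hε]
    have hj : |besselJ j y| ≤ |(p j : ℝ)| + e := by
      have h := hp j (by omega)
      have h2 := abs_sub_abs_le_abs_sub (besselJ j y) (p j : ℝ)
      rw [abs_sub_comm] at h
      linarith
    have hε0 : 0 ≤ (if (j : ℕ) = 0 then (1 : ℝ) else 2) := by split_ifs <;> norm_num
    exact mul_le_mul_of_nonneg_left hj hε0
  have h0 : 0 ≤ ∏ j : Fin (J + 1), |((if (j : ℕ) = 0 then (1 : ℝ) else 2) * besselJ j y) ^ k j| :=
    Finset.prod_nonneg fun j _ => abs_nonneg _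
  calc |(reIPow (cntOrderSum k) : ℝ)| * ∏ j : Fin (J + 1), |((if (j : ℕ) = 0 then (1 : ℝ) else 2) * besselJ j y) ^ k j|
      ≤ 1 * ∏ j : Fin (J + 1), ((if (j : ℕ) = 0 then (1 : ℝ) else 2) * (|(p j : ℝ)| + e)) ^ k j := by
        gcongr
    _ = _ := by rw [one_mul]

/-- The decided sign is right: `0 ≤ cntCoef k y · cntSgnQ p e k`. [folklore] -/
private theorem cntCoef_mul_cntSgnQ_nonneg {J : ℕ} (k : Fin (J + 1) → ℕ) {y : ℝ} {p : ℕ → ℚ} {e : ℚ}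
    (hp : ∀ j : ℕ, j ≤ J → |(p j : ℝ) - besselJ j y| ≤ (e : ℝ)) :
    0 ≤ cntCoef k y * (cntSgnQ p e k : ℝ) := by
  unfold cntCoef cntSgnQ
  push_cast
  have hσ : ∀ j : Fin (J + 1), 0 ≤ ((if (j : ℕ) = 0 then (1 : ℝ) else 2) * besselJ j y) ^ k j
      * (if k j % 2 = 0 then (1 : ℝ) else if e < p j then 1 else if p j < -e then -1 else 0) := by
    intro j
    have h := hp j (by omega)
    have hε0 : 0 < (if (j : ℕ) = 0 then (1 : ℝ) else 2) := by split_ifs <;> norm_num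
    by_cases h2 : k j % 2 = 0
    · rw [if_pos h2, mul_one]
      obtain ⟨r, hr⟩ : ∃ r, k j = 2 * r := ⟨k j / 2, by omega⟩
      rw [hr, pow_mul]
      positivity
    · rw [if_neg h2]
      obtain ⟨r, hr⟩ : ∃ r, k j = 2 * r + 1 := ⟨k j / 2, by omega⟩
      by_cases hpos : e < p j
      · rw [if_pos hpos, mul_one]
        have hJ : 0 ≤ besselJ j y := by
          have : ((e : ℚ) : ℝ) < (p j : ℝ) := by exact_mod_cast hpos
          rw [abs_le] at h; linarith
        positivity
      · rw [if_neg hpos]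
        by_cases hneg : p j < -e
        · rw [if_pos hneg]
          have hJ : besselJ j y ≤ 0 := by
            have : (p j : ℝ) < -((e : ℚ) : ℝ) := by exact_mod_cast hneg
            rw [abs_le] at h; linarith
          have hb : ((if (j : ℕ) = 0 then (1 : ℝ) else 2) * besselJ j y) ≤ 0 :=
            mul_nonpos_of_nonneg_of_nonpos hε0.le hJ
          rw [hr, pow_succ, pow_mul]
          have hsq : 0 ≤ (((if (j : ℕ) = 0 then (1 : ℝ) else 2) * besselJ j y) ^ 2) ^ r := by positivity
          nlinarith
        · rw [if_neg hneg, mul_zero]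
  rw [mul_mul_mul_comm, ← Finset.prod_mul_distrib]
  have hre : 0 ≤ (reIPow (cntOrderSum k) : ℝ) * (reIPow (cntOrderSum k) : ℝ) := mul_self_nonneg _
  exact mul_nonneg hre (Finset.prod_nonneg fun j _ => hσ j)

/-- `Re(i^{s(k)}) = 0 → cntCoef k y = 0`. [folklore] -/
private theorem cntCoef_eq_zero_of_reIPow {J : ℕ} (k : Fin (J + 1) → ℕ) (y : ℝ) (h : reIPow (cntOrderSum k) = 0) :
    cntCoef k y = 0 := by
  unfold cntCoef; rw [h]; simp

/-- **THE m-UNIFORM ENVELOPE, literal form.** For `2(n+1)+1 ≤ d`, `m ≠ 0`, `M ≤ |m|`, a truncation order `J`,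
rational Bessel literals `|p_j − J_j(β/d)| ≤ e` (`j ≤ J`), an order-tail bound `δ_J(β/d) ≤ δ̄`, a seed table on the
count vectors `srwI d (n+1) 0 (cntProfile d k M) ≤ U k`, two-level seeds `srwI(((J+1)M)(e_0+…+e_k)) ≤ I k` and
`srwI d (n+1) 0 0 ≤ T̄`:
`|Tw_{n+1}(m e_i; β) − p_0^d · srwI d (n+1) 0 0| ≤ envQ + Σ_{k<d} C(d,k+1)(2δ̄)^{k+1} I k + d·e·(|p_0|+e)^{d−1}·T̄`
for ALL `|m| ≥ M` at once — rational right-hand side, decided by the kernel in a consumer. [cite: FitznerVanDerHofstad2016NoBLE, (3.34)–(3.36) p. 1071, §5.1.1 (5.2)–(5.5) pp. 1089–1090; DLMF, 10.2.2, 10.14.4, 10.35.2] -/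
theorem abs_srwTwist_sub_lit_pow_mul_srwI_le_envelope_cast (n : ℕ) (hd : 2 * (n + 1) + 1 ≤ d) (i : Fin d)
    {m : ℤ} (hm : m ≠ 0) (β : ℝ) (J M : ℕ) (hM : M ≤ m.natAbs)
    {p : ℕ → ℚ} {e δb T : ℚ} {U : (Fin (J + 1) → ℕ) → ℚ} {I : ℕ → ℚ}
    (hp : ∀ j : ℕ, j ≤ J → |(p j : ℝ) - besselJ j (β / d)| ≤ (e : ℝ))
    (hδ : ∑' l : ℕ, |besselJ (l + J + 1) (β / d)| ≤ (δb : ℝ))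
    (hU : ∀ k ∈ Finset.Nat.antidiagonalTuple (J + 1) d, k 0 ≠ d →
      srwI d (n + 1) 0 (cntProfile d k (M : ℤ)) ≤ ((U k : ℚ) : ℝ))
    (hIk : ∀ k ∈ Finset.range d,
      srwI d (n + 1) 0 (fun μ : Fin d => if (μ : ℕ) < k + 1 then ((((J + 1) * M : ℕ)) : ℤ) else 0)
        ≤ ((I k : ℚ) : ℝ))
    (hT : srwI d (n + 1) 0 (fun _ => 0) ≤ (T : ℝ)) :
    |srwTwist d (n + 1) (fun _ => 1) (Pi.single i m) β - ((p 0 : ℚ) : ℝ) ^ d * srwI d (n + 1) 0 (fun _ => 0)|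
      ≤ (((envQ d J p e U + ∑ k ∈ Finset.range d, (d.choose (k + 1) : ℚ) * (2 * δb) ^ (k + 1) * I k
          + d * e * (|p 0| + e) ^ (d - 1) * T) : ℚ) : ℝ) := by
  have hd3 : 2 * n + 3 ≤ d := by omega
  have hd1 : 1 ≤ d := by omega
  set y : ℝ := β / d with hy
  set T0 := srwI d (n + 1) 0 (fun _ : Fin d => (0 : ℤ)) with hT0
  have hT00 : 0 ≤ T0 := srwI_nonneg (n + 1) hd 0 _
  -- (1) the truncation remainder
  have hrem := abs_srwTwist_sub_rowTrunc_le_sum_srwI_unit n hd i hm β J M hM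
  have hδ0 : 0 ≤ ∑' l : ℕ, |besselJ (l + J + 1) (β / d)| := tsum_nonneg fun l => abs_nonneg _
  have hremQ : ∑ k ∈ Finset.range d, (d.choose (k + 1) : ℝ)
        * (2 * ∑' l : ℕ, |besselJ (l + J + 1) (β / d)|) ^ (k + 1)
        * srwI d (n + 1) 0 (fun μ : Fin d => if (μ : ℕ) < k + 1 then ((((J + 1) * M : ℕ)) : ℤ) else 0)
      ≤ ∑ k ∈ Finset.range d, (d.choose (k + 1) : ℝ) * (2 * (δb : ℝ)) ^ (k + 1) * ((I k : ℚ) : ℝ) := by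
    refine Finset.sum_le_sum fun k hk => ?_
    have hI0 : 0 ≤ srwI d (n + 1) 0
        (fun μ : Fin d => if (μ : ℕ) < k + 1 then ((((J + 1) * M : ℕ)) : ℤ) else 0) := srwI_nonneg (n + 1) hd 0 _
    have h2 : (2 * ∑' l : ℕ, |besselJ (l + J + 1) (β / d)|) ^ (k + 1) ≤ (2 * (δb : ℝ)) ^ (k + 1) :=
      pow_le_pow_left₀ (by positivity) (by linarith) _
    have hc : (0 : ℝ) ≤ (d.choose (k + 1) : ℝ) := Nat.cast_nonneg _
    calc (d.choose (k + 1) : ℝ) * (2 * ∑' l : ℕ, |besselJ (l + J + 1) (β / d)|) ^ (k + 1)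
          * srwI d (n + 1) 0 (fun μ : Fin d => if (μ : ℕ) < k + 1 then ((((J + 1) * M : ℕ)) : ℤ) else 0)
        ≤ (d.choose (k + 1) : ℝ) * (2 * (δb : ℝ)) ^ (k + 1)
          * srwI d (n + 1) 0 (fun μ : Fin d => if (μ : ℕ) < k + 1 then ((((J + 1) * M : ℕ)) : ℤ) else 0) := by
          gcongr
      _ ≤ (d.choose (k + 1) : ℝ) * (2 * (δb : ℝ)) ^ (k + 1) * ((I k : ℚ) : ℝ) := by
          have hδb : (0 : ℝ) ≤ 2 * (δb : ℝ) := by linarith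
          exact mul_le_mul_of_nonneg_left (hIk k hk) (by positivity)
  -- (2) the envelope of the row-truncated object
  have hUreal : ∀ k ∈ (Finset.univ : Finset (Fin (J + 1))).piAntidiag d,
      srwI d (n + 1) 0 (cntProfile d k (M : ℤ))
        ≤ (fun k => if k 0 = d then T0 else ((U k : ℚ) : ℝ)) k := by
    intro k hk
    by_cases h0 : k 0 = d
    · have hsum : ∑ j, k j = d := by rw [Finset.mem_piAntidiag] at hk; simpa using hk.1
      simp only [h0, if_true]
      rw [eq_cntZero_of_apply_zero hsum h0, cntProfile_cntZero]
    · simp only [h0, if_false]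
      rw [Finset.piAntidiag_univ_fin_eq_antidiagonalTuple] at hk
      exact hU k hk h0
  have henv := abs_rowTruncObj_sub_main_le n hd J M hM β hUreal
  -- compare the real envelope with the rational one, termwise
  have hA : ((Finset.univ : Finset (Fin (J + 1))).piAntidiag d) = Finset.Nat.antidiagonalTuple (J + 1) d :=
    Finset.piAntidiag_univ_fin_eq_antidiagonalTuple d (J + 1)
  have hne : ∀ k ∈ ((Finset.univ : Finset (Fin (J + 1))).piAntidiag d).erase (cntZero d J), k 0 ≠ d := by
    intro k hk h0
    have hk' := Finset.mem_of_mem_erase hk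
    have hsum : ∑ j, k j = d := by rw [Finset.mem_piAntidiag] at hk'; simpa using hk'.1
    exact (Finset.ne_of_mem_erase hk) (eq_cntZero_of_apply_zero hsum h0)
  have hU0 : ∀ k ∈ ((Finset.univ : Finset (Fin (J + 1))).piAntidiag d).erase (cntZero d J),
      0 ≤ ((U k : ℚ) : ℝ) := by
    intro k hk
    have hk' := Finset.mem_of_mem_erase hk
    have h0 := hne k hk
    rw [hA] at hk'
    exact (srwI_nonneg (n + 1) hd 0 _).trans (hU k hk' h0)
  have hmag0 : ∀ k : Fin (J + 1) → ℕ, 0 ≤ ((cntMagQ p e k : ℚ) : ℝ) := fun k =>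
    (abs_nonneg _).trans (abs_cntCoef_le_cntMagQ k hp)
  have hTermQ : ∀ k : Fin (J + 1) → ℕ, ((cntTermQ p e U k : ℚ) : ℝ)
      = (Nat.multinomial Finset.univ k : ℝ) * ((cntMagQ p e k : ℚ) : ℝ) * ((U k : ℚ) : ℝ) := by
    intro k; unfold cntTermQ; push_cast; ring
  -- nonnegativity of every rational term on the full index set
  have hQ0 : ∀ (pos : Bool), ∀ k ∈ (Finset.univ : Finset (Fin (J + 1))).piAntidiag d,
      k ∉ ((Finset.univ : Finset (Fin (J + 1))).piAntidiag d).erase (cntZero d J) →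
      (0 : ℝ) ≤ (((if k 0 = d then 0 else if reIPow (cntOrderSum k) = 0 then 0
        else if cntSgnQ p e k = (if pos then -1 else 1) then 0 else cntTermQ p e U k : ℚ)) : ℝ) := by
    intro pos k hk hknot
    have hk0 : k = cntZero d J := by
      by_contra hne
      exact hknot (Finset.mem_erase.mpr ⟨hne, hk⟩)
    have h0 : k 0 = d := by rw [hk0]; exact cntZero_apply_zero d J
    rw [if_pos h0]; simp
  -- termwise comparison on the punctured index set
  have hQ1 : ∀ (pos : Bool), ∀ k ∈ ((Finset.univ : Finset (Fin (J + 1))).piAntidiag d).erase (cntZero d J),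
      (Nat.multinomial Finset.univ k : ℝ) * max (if pos then cntCoef k y else -cntCoef k y) 0
          * (fun k => if k 0 = d then T0 else ((U k : ℚ) : ℝ)) k
        ≤ (((if k 0 = d then 0 else if reIPow (cntOrderSum k) = 0 then 0
          else if cntSgnQ p e k = (if pos then -1 else 1) then 0 else cntTermQ p e U k : ℚ)) : ℝ) := by
    intro pos k hk
    have h0 := hne k hk
    have hk0 := hU0 k hk
    simp only [h0, if_false]
    by_cases hre : reIPow (cntOrderSum k) = 0
    · rw [if_pos hre, cntCoef_eq_zero_of_reIPow k y hre]
      cases pos <;> simp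
    · rw [if_neg hre]
      have hsg := cntCoef_mul_cntSgnQ_nonneg k hp (y := y)
      by_cases hs : cntSgnQ p e k = (if pos then -1 else 1)
      · rw [if_pos hs]
        have hmax : max (if pos then cntCoef k y else -cntCoef k y) 0 = 0 := by
          cases pos
          · simp only [Bool.false_eq_true, if_false] at hs ⊢
            rw [hs] at hsg; simp at hsg
            exact max_eq_right (by linarith)
          · simp only [if_true] at hs ⊢
            rw [hs] at hsg; simp at hsg
            exact max_eq_right (by linarith)
        rw [hmax]; simp
      · rw [if_neg hs, hTermQ]
        have h1 : max (if pos then cntCoef k y else -cntCoef k y) 0 ≤ ((cntMagQ p e k : ℚ) : ℝ) := by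
          refine max_le ?_ (hmag0 k)
          cases pos
          · exact (neg_le_abs _).trans (abs_cntCoef_le_cntMagQ k hp)
          · exact (le_abs_self _).trans (abs_cntCoef_le_cntMagQ k hp)
        have h2 : 0 ≤ max (if pos then cntCoef k y else -cntCoef k y) 0 := le_max_right _ _
        have h3 : (Nat.multinomial Finset.univ k : ℝ) * max (if pos then cntCoef k y else -cntCoef k y) 0
              * ((U k : ℚ) : ℝ)
            ≤ (Nat.multinomial Finset.univ k : ℝ) * ((cntMagQ p e k : ℚ) : ℝ) * ((U k : ℚ) : ℝ) := by
          gcongr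
        exact h3
  have hNEG : (∑ k ∈ ((Finset.univ : Finset (Fin (J + 1))).piAntidiag d).erase (cntZero d J),
        (Nat.multinomial Finset.univ k : ℝ) * max (-cntCoef k y) 0
          * (fun k => if k 0 = d then T0 else ((U k : ℚ) : ℝ)) k)
      ≤ ((negEnvQ d J p e U : ℚ) : ℝ) := by
    unfold negEnvQ
    rw [Rat.cast_sum, ← hA]
    have s1 := Finset.sum_le_sum (hQ1 false)
    have s2 := Finset.sum_le_sum_of_subset_of_nonneg (Finset.erase_subset (cntZero d J) _) (hQ0 false)
    simp only [Bool.false_eq_true, if_false] at s1 s2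
    exact s1.trans s2
  have hPOS : (∑ k ∈ ((Finset.univ : Finset (Fin (J + 1))).piAntidiag d).erase (cntZero d J),
        (Nat.multinomial Finset.univ k : ℝ) * max (cntCoef k y) 0
          * (fun k => if k 0 = d then T0 else ((U k : ℚ) : ℝ)) k)
      ≤ ((posEnvQ d J p e U : ℚ) : ℝ) := by
    unfold posEnvQ
    rw [Rat.cast_sum, ← hA]
    have s1 := Finset.sum_le_sum (hQ1 true)
    have s2 := Finset.sum_le_sum_of_subset_of_nonneg (Finset.erase_subset (cntZero d J) _) (hQ0 true)
    simp only [if_true] at s1 s2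
    exact s1.trans s2
  have henvQ : |rowTruncObj d n J m β - besselJ 0 y ^ d * T0| ≤ ((envQ d J p e U : ℚ) : ℝ) := by
    refine henv.trans ?_
    unfold envQ; push_cast
    exact max_le_max hNEG hPOS
  -- (3) the literal main term
  have hmain : |besselJ 0 y ^ d * T0 - ((p 0 : ℚ) : ℝ) ^ d * T0|
      ≤ (d : ℝ) * (e : ℝ) * (|((p 0 : ℚ) : ℝ)| + e) ^ (d - 1) * (T : ℝ) := by
    rw [← sub_mul, abs_mul, abs_of_nonneg hT00]
    have hq := hp 0 (Nat.zero_le _)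
    have he0 : (0 : ℝ) ≤ e := (abs_nonneg _).trans hq
    have hpw : |besselJ 0 y ^ d - ((p 0 : ℚ) : ℝ) ^ d| ≤ (d : ℝ) * (e : ℝ) * (|((p 0 : ℚ) : ℝ)| + e) ^ (d - 1) := by
      have h := abs_pow_sub_pow_le (besselJ 0 y) (((p 0 : ℚ) : ℝ)) d
      have hx : |besselJ 0 y| ≤ |((p 0 : ℚ) : ℝ)| + e := by
        have h2 := abs_sub_abs_le_abs_sub (besselJ 0 y) ((p 0 : ℚ) : ℝ)
        rw [abs_sub_comm] at hq; linarith
      have hxq : |besselJ 0 y - ((p 0 : ℚ) : ℝ)| ≤ e := by rw [abs_sub_comm]; exact hq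
      calc |besselJ 0 y ^ d - ((p 0 : ℚ) : ℝ) ^ d|
          ≤ |besselJ 0 y - ((p 0 : ℚ) : ℝ)| * d * max |besselJ 0 y| |((p 0 : ℚ) : ℝ)| ^ (d - 1) := h
        _ ≤ (e : ℝ) * d * (|((p 0 : ℚ) : ℝ)| + e) ^ (d - 1) := by
            have hmx : max |besselJ 0 y| |((p 0 : ℚ) : ℝ)| ≤ |((p 0 : ℚ) : ℝ)| + e :=
              max_le hx (by linarith)
            have hmx0 : 0 ≤ max |besselJ 0 y| |((p 0 : ℚ) : ℝ)| := le_max_of_le_left (abs_nonneg _)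
            gcongr
        _ = (d : ℝ) * (e : ℝ) * (|((p 0 : ℚ) : ℝ)| + e) ^ (d - 1) := by ring
    calc |besselJ 0 y ^ d - ((p 0 : ℚ) : ℝ) ^ d| * T0
        ≤ ((d : ℝ) * (e : ℝ) * (|((p 0 : ℚ) : ℝ)| + e) ^ (d - 1)) * T0 :=
          mul_le_mul_of_nonneg_right hpw hT00
      _ ≤ ((d : ℝ) * (e : ℝ) * (|((p 0 : ℚ) : ℝ)| + e) ^ (d - 1)) * (T : ℝ) := by
          have : (0 : ℝ) ≤ (d : ℝ) * (e : ℝ) * (|((p 0 : ℚ) : ℝ)| + e) ^ (d - 1) := by positivity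
          exact mul_le_mul_of_nonneg_left hT this
  -- assemble
  have htri : |srwTwist d (n + 1) (fun _ => 1) (Pi.single i m) β - ((p 0 : ℚ) : ℝ) ^ d * T0|
      ≤ |srwTwist d (n + 1) (fun _ => 1) (Pi.single i m) β - rowTruncObj d n J m β|
        + |rowTruncObj d n J m β - besselJ 0 y ^ d * T0|
        + |besselJ 0 y ^ d * T0 - ((p 0 : ℚ) : ℝ) ^ d * T0| := by
    have h1 := abs_sub_le (srwTwist d (n + 1) (fun _ => 1) (Pi.single i m) β) (rowTruncObj d n J m β)
      (((p 0 : ℚ) : ℝ) ^ d * T0)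
    have h2 := abs_sub_le (rowTruncObj d n J m β) (besselJ 0 y ^ d * T0) (((p 0 : ℚ) : ℝ) ^ d * T0)
    linarith
  have hremR : |srwTwist d (n + 1) (fun _ => 1) (Pi.single i m) β - rowTruncObj d n J m β|
      ≤ ∑ k ∈ Finset.range d, (d.choose (k + 1) : ℝ) * (2 * (δb : ℝ)) ^ (k + 1) * ((I k : ℚ) : ℝ) := by
    unfold rowTruncObj; exact hrem.trans hremQ
  push_cast
  linarith [htri, hremR, henvQ, hmain]


/-! ### The two-level reduction of the profile seeds and the nonzero-count corollary -/

/-- Every entry of the order pattern over `L` is an order `j ∈ L` with `k j ≠ 0`. [folklore] -/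
private theorem exists_of_mem_cntPatternAux {J : ℕ} {k : Fin (J + 1) → ℕ} {L : List (Fin (J + 1))} {a : ℕ}
    (ha : a ∈ cntPatternAux k L) : ∃ j ∈ L, k j ≠ 0 ∧ a = j := by
  unfold cntPatternAux at ha
  rw [List.mem_flatMap] at ha
  obtain ⟨j, hjL, hj⟩ := ha
  rw [List.mem_replicate] at hj
  exact ⟨j, hjL, hj.1, hj.2⟩

/-- The order pattern is the block of nonzero orders followed by `k 0` zeros. [folklore] -/
private theorem cntPattern_eq_append {J : ℕ} (k : Fin (J + 1) → ℕ) :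
    cntPattern k = cntPatternAux k ((List.finRange J).map Fin.succ) ++ List.replicate (k 0) 0 := by
  unfold cntPattern cntOrderList cntPatternAux
  rw [List.flatMap_append]
  simp

/-- The block of nonzero orders has `Σ_j k_j − k_0` entries. [folklore] -/
private theorem length_cntPatternAux_succ {J : ℕ} (k : Fin (J + 1) → ℕ) :
    (cntPatternAux k ((List.finRange J).map Fin.succ)).length = (∑ j, k j) - k 0 := by
  rw [length_cntPatternAux, List.map_map, Fin.sum_univ_succ, ← Fin.sum_univ_def]
  simp

/-- The first `Σ_j k_j − k_0` pattern entries are nonzero orders (`≥ 1`). [folklore] -/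
private theorem one_le_cntPattern_getD {J : ℕ} (k : Fin (J + 1) → ℕ) {μ : ℕ} (hμ : μ < (∑ j, k j) - k 0) :
    1 ≤ (cntPattern k).getD μ 0 := by
  rw [cntPattern_eq_append]
  set P := cntPatternAux k ((List.finRange J).map Fin.succ) with hP
  have hlen : P.length = (∑ j, k j) - k 0 := length_cntPatternAux_succ k
  have hμ' : μ < P.length := by rw [hlen]; exact hμ
  rw [List.getD_append _ _ _ _ hμ', List.getD_eq_getElem _ _ hμ']
  obtain ⟨j, hjL, _, hj⟩ := exists_of_mem_cntPatternAux (List.getElem_mem hμ' : P[μ] ∈ P)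
  rw [List.mem_map] at hjL
  obtain ⟨i, _, rfl⟩ := hjL
  rw [hj, Fin.val_succ]
  omega

/-- **Profile seeds are majorised by two-level seeds**: for a count vector with `Σ_j k_j = d` and `k_0 < d`,
`srwI d (n+1) 0 (cntProfile d k M) ≤ srwI d (n+1) 0 (M(e_0 + … + e_{d-k_0-1}))` (the nonzero coordinates of the
profile point are `≥ M` in absolute value, and there are `d − k_0 ≥ 1` of them; `absMonotone_srwI`). [cite: FitznerVanDerHofstad2016NoBLE, Lemma 5.1 p. 1093] -/
theorem srwI_cntProfile_le_twoLevel (n : ℕ) (hd : 2 * (n + 1) + 1 ≤ d) {J : ℕ} {k : Fin (J + 1) → ℕ}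
    (hk : ∑ j, k j = d) (hk0 : k 0 < d) (M : ℕ) :
    srwI d (n + 1) 0 (cntProfile d k (M : ℤ))
      ≤ srwI d (n + 1) 0 (fun μ : Fin d => if (μ : ℕ) < (d - k 0 - 1) + 1 then (M : ℤ) else 0) := by
  refine absMonotone_srwI (d := d) (n := n + 1) (by omega) hd 0 _ _ fun μ => ?_
  by_cases hμ : (μ : ℕ) < (d - k 0 - 1) + 1
  · rw [if_pos hμ]
    have hμ' : (μ : ℕ) < (∑ j, k j) - k 0 := by rw [hk]; omega
    have h1 := one_le_cntPattern_getD k hμ'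
    unfold cntProfile
    rw [abs_mul, Nat.abs_cast, Nat.abs_cast]
    have : (1 : ℤ) ≤ (((cntPattern k).getD (μ : ℕ) 0 : ℕ) : ℤ) := by exact_mod_cast h1
    nlinarith
  · rw [if_neg hμ, abs_zero]; exact abs_nonneg _

/-- The closed rational form of the nonzero-count envelope bound: `envQ(U_k := I(d−k_0−1)) + Σ_{c<d} C(d,c+1)(2δ̄)^{c+1} I c
+ d·e·(|p_0|+e)^{d−1}·T̄`. [cite: FitznerVanDerHofstad2016NoBLE, §5.1.1 (5.2)–(5.5) pp. 1089–1090] -/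
def envBoundQ (d J : ℕ) (p : ℕ → ℚ) (e δb T : ℚ) (I : ℕ → ℚ) : ℚ :=
  envQ d J p e (fun k => I (d - k 0 - 1))
    + ∑ k ∈ Finset.range d, (d.choose (k + 1) : ℚ) * (2 * δb) ^ (k + 1) * I k
    + d * e * (|p 0| + e) ^ (d - 1) * T

/-- **THE m-UNIFORM ENVELOPE, nonzero-count classes.** As `abs_srwTwist_sub_lit_pow_mul_srwI_le_envelope_cast`, with
the seed table read off ONE two-level table `I c ≥ srwI d (n+1) 0 (M(e_0+…+e_c))` (`c < d`): the profile seed of a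
count vector `k` is majorised by the two-level seed with `d − k_0` coordinates `M` (`srwI_cntProfile_le_twoLevel`),
and the remainder seeds at `(J+1)M` by the same table (`(J+1)M ≥ M`, `absMonotone_srwI`):
`|Tw_{n+1}(m e_i; β) − p_0^d·srwI d (n+1) 0 0| ≤ envBoundQ = envQ(U_k := I(d−k_0−1)) + Σ_{c<d} C(d,c+1)(2δ̄)^{c+1} I c
+ d·e·(|p_0|+e)^{d−1}·T̄` for ALL `|m| ≥ M`. [cite: FitznerVanDerHofstad2016NoBLE, (3.34)–(3.36) p. 1071, §5.1.1 (5.2)–(5.5) pp. 1089–1090, Lemma 5.1 p. 1093; DLMF, 10.2.2, 10.14.4, 10.35.2] -/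
theorem abs_srwTwist_sub_lit_pow_mul_srwI_le_envelope_twoLevel_cast (n : ℕ) (hd : 2 * (n + 1) + 1 ≤ d)
    (i : Fin d) {m : ℤ} (hm : m ≠ 0) (β : ℝ) (J M : ℕ) (hM : M ≤ m.natAbs)
    {p : ℕ → ℚ} {e δb T : ℚ} {I : ℕ → ℚ}
    (hp : ∀ j : ℕ, j ≤ J → |(p j : ℝ) - besselJ j (β / d)| ≤ (e : ℝ))
    (hδ : ∑' l : ℕ, |besselJ (l + J + 1) (β / d)| ≤ (δb : ℝ))
    (hI : ∀ c ∈ Finset.range d,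
      srwI d (n + 1) 0 (fun μ : Fin d => if (μ : ℕ) < c + 1 then (M : ℤ) else 0) ≤ ((I c : ℚ) : ℝ))
    (hT : srwI d (n + 1) 0 (fun _ => 0) ≤ (T : ℝ)) :
    |srwTwist d (n + 1) (fun _ => 1) (Pi.single i m) β - ((p 0 : ℚ) : ℝ) ^ d * srwI d (n + 1) 0 (fun _ => 0)|
      ≤ ((envBoundQ d J p e δb T I : ℚ) : ℝ) := by
  unfold envBoundQ
  refine abs_srwTwist_sub_lit_pow_mul_srwI_le_envelope_cast n hd i hm β J M hM hp hδ ?_ ?_ hT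
  · intro k hk h0
    rw [← Finset.piAntidiag_univ_fin_eq_antidiagonalTuple, Finset.mem_piAntidiag] at hk
    have hsum : ∑ j, k j = d := by simpa using hk.1
    have hk0 : k 0 < d := by
      have : k 0 ≤ ∑ j, k j := Finset.single_le_sum (fun j _ => Nat.zero_le (k j)) (Finset.mem_univ 0)
      omega
    exact (srwI_cntProfile_le_twoLevel n hd hsum hk0 M).trans (hI (d - k 0 - 1) (by rw [Finset.mem_range]; omega))
  · intro k hk
    refine le_trans ?_ (hI k hk)
    refine absMonotone_srwI (d := d) (n := n + 1) (by omega) hd 0 _ _ fun μ => ?_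
    by_cases hμ : (μ : ℕ) < k + 1
    · rw [if_pos hμ, if_pos hμ, Nat.abs_cast, Nat.abs_cast]
      exact_mod_cast (Nat.le_mul_of_pos_left M (Nat.succ_pos J))
    · rw [if_neg hμ, if_neg hμ]

/-! ### The Bessel order tail `δ_J(y) = Σ_{l≥0} |J_{l+J+1}(y)|` from a 24-digit literal table -/

/-- The rational order-tail bound read from a 24-digit literal table `Q` of `J_j(y)`, `j < 17`, for a truncation
order `J ≤ 15`: `Σ_{l<16−J} (|Q (l+J+1)|+1)/10²⁴ + (y/2)¹⁷/17! · 18/(18 − y/2)`. [cite: DLMF, §10.14.4] -/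
def besselTailJQ (J : ℕ) (Y : ℚ) (Q : ℕ → ℤ) : ℚ :=
  (∑ l ∈ Finset.range (16 - J), ((((|Q (l + J + 1)| : ℤ) : ℚ) / 10 ^ 24 + 1 / 10 ^ 24)))
    + (Y / 2) ^ 17 / ((17)! : ℚ) * 18 / (18 - Y / 2)

/-- **`Σ_{l≥0} |J_{l+J+1}(y)| ≤ besselTailJQ J y Q`** for `J ≤ 15`, `0 ≤ y`, `y² ≤ 4(J+2)` and a table with
`|Q_j/10²⁴ − J_j(y)| ≤ 10⁻²⁴` (`j < 17`): the orders `J+1 … 16` by the table, the rest geometrically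
(`tsum_abs_besselJ_orderTail_le_sum_add_geom`, `K = 16 − J`). [cite: DLMF, §10.14.4] -/
theorem tsum_abs_besselJ_orderTail_le_besselTailJQ {J : ℕ} (hJ : J ≤ 15) {Y : ℚ} (hY0 : 0 ≤ Y)
    (hY : Y ^ 2 ≤ 4 * ((J : ℚ) + 2)) {Q : ℕ → ℤ}
    (htab : ∀ j : ℕ, j < 17 → |((Q j : ℤ) : ℝ) / (10 ^ 24 : ℝ) - besselJ j ((Y : ℚ) : ℝ)| ≤ 1 / 10 ^ 24) :
    ∑' l : ℕ, |besselJ (l + J + 1) ((Y : ℚ) : ℝ)| ≤ ((besselTailJQ J Y Q : ℚ) : ℝ) := by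
  have hy0 : (0 : ℝ) ≤ ((Y : ℚ) : ℝ) := by exact_mod_cast hY0
  have h4 : ((Y : ℚ) : ℝ) ^ 2 ≤ 4 * ((J : ℕ) + 2 : ℝ) := by
    have h : ((Y : ℚ) : ℝ) ^ 2 ≤ 4 * ((J : ℝ) + 2) := by exact_mod_cast hY
    linarith
  have htail := tsum_abs_besselJ_orderTail_le_sum_add_geom J (16 - J) h4
  have h16 : J + (16 - J) = 16 := by omega
  rw [h16] at htail
  have hj : ∀ j, j < 17 → |besselJ j ((Y : ℚ) : ℝ)| ≤ ((|Q j| : ℤ) : ℝ) / 10 ^ 24 + 1 / 10 ^ 24 := by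
    intro j hj
    have h := htab j hj
    have h1 : |besselJ j ((Y : ℚ) : ℝ)| ≤ |((Q j : ℤ) : ℝ) / (10 ^ 24 : ℝ)| + 1 / 10 ^ 24 := by
      have h2 := abs_sub_abs_le_abs_sub (besselJ j ((Y : ℚ) : ℝ)) (((Q j : ℤ) : ℝ) / (10 ^ 24 : ℝ))
      rw [abs_sub_comm] at h
      linarith
    rw [abs_div, abs_of_pos (by positivity : (0 : ℝ) < 10 ^ 24), ← Int.cast_abs] at h1
    exact h1
  have htl : |((Y : ℚ) : ℝ) / 2| ^ (16 + 1) / ((16 + 1)! : ℝ) * (((16 : ℕ) : ℝ) + 2)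
        / ((((16 : ℕ) : ℝ) + 2) - |((Y : ℚ) : ℝ) / 2|)
      = (((Y : ℚ) : ℝ) / 2) ^ 17 / ((17)! : ℝ) * 18 / (18 - ((Y : ℚ) : ℝ) / 2) := by
    rw [abs_of_nonneg (by linarith : (0 : ℝ) ≤ ((Y : ℚ) : ℝ) / 2)]
    norm_num
  calc ∑' l : ℕ, |besselJ (l + J + 1) ((Y : ℚ) : ℝ)|
      ≤ (∑ l ∈ Finset.range (16 - J), ((((|Q (l + J + 1)| : ℤ) : ℝ) / 10 ^ 24 + 1 / 10 ^ 24)))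
          + (((Y : ℚ) : ℝ) / 2) ^ 17 / ((17)! : ℝ) * 18 / (18 - ((Y : ℚ) : ℝ) / 2) :=
        htail.trans (add_le_add
          (Finset.sum_le_sum fun l hl => hj _ (by rw [Finset.mem_range] at hl; omega)) htl.le)
    _ = ((besselTailJQ J Y Q : ℚ) : ℝ) := by
        simp only [besselTailJQ]
        push_cast
        ring

end Literature.Probability.FitznerVanDerHofstad2017

end
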